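import Summits.AtomisticToContinuum.Crystallization.Theorems.ChargedEnergyGap.Negative.Unconditional
import Literature.MathematicalPhysics.StatisticalMechanics.Yuhjtman2015
import HarnessLib

/-!
# SeparationCeilingDoor — the exchange rate of the chemical-potential door (helper, supports item 30303)

Helper for route `ContactSaturationLadder`, crux `LooseTextureRung` (stmt-AtomisticToContinuum-30303), registered line
«SieveDepthLadder» v4, stub `stub_incrementFloor65 : ∀ N, −6/5 ≤ E(N+1) − E(N)` (lens-1), and for lens-5's capacity stubs.

* `SepGS δ` — ground-state separation: all pair distances of every Lennard-Jones ground state are `≥ δ` (units `r₀ = 1`);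
  `sepGS_pos` (some `δ > 0`, tree), `sepGS_of_yuhjtman` (`δ = 0.684` from the named fact `Yuhjtman2015_minDistance`).
* `HalfSpaceCap T δ` — pure finite geometry: a `δ`-separated point set in a closed half-space, each point at distance `≥ δ`
  from the boundary point `0`, binds a particle at `0` by at most `T`.
* `HullBinding E`, `IncrementFloor T` — the two door forms; `incrementFloor_of_hullBinding` (removal, the argument of
  `GrandCanonicalSelectionKosselPointwise.siteEnergy_le_increment`, inlined to keep this file route-independent).
* KERNEL `hullBinding_of_sep_cap : SepGS δ → HalfSpaceCap T δ → HullBinding T` — the particle of a ground state farthest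
  from particle `0` sees all other particles in a closed half-space (`inner_nonneg_of_dist_le`); whence
  `incrementFloor_of_sep_cap : SepGS δ → HalfSpaceCap T δ → IncrementFloor T` for every `T, δ`.
* `hullBinding_two_eStar`, `incrementFloor_two_eStar` — the door at `T = 2|e⋆|` is a theorem (`card_mul_eStar_le`).

Price memo (not formalised): the printed separation constant is `0.684` (Yuhjtman 2015; still best, arXiv:2511.15008),
conjectured sharp value `2^{-1/6} ≈ 0.8909` (ibid.), empirical `0.903` (LJ₉₂₃); explicit half-space competitors bind by
`≥ 1.216` at `δ = 0.85` and `≥ 1.097` at `δ = 0.8909`, so the `T = 6/5` door needs `SepGS δ` with `δ > 0.85`.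
-/

noncomputable section

open scoped BigOperators
open Literature.MathematicalPhysics.StatisticalMechanics
open Summit.AtomisticToContinuum.Crystallization.Theorems

namespace Summit.AtomisticToContinuum.Crystallization.Theorems.SeparationCeilingDoor

/-- Ambient space. -/
abbrev E3 : Type := EuclideanSpace ℝ (Fin 3)

/-- `SepGS δ` — in every Lennard-Jones ground state (any `N`) all pair distances are `≥ δ`. [folklore] -/
def SepGS (δ : ℝ) : Prop :=
  ∀ (N : ℕ) (y : Fin N → E3), IsGroundState lennardJones y → ∀ i j : Fin N, i ≠ j → δ ≤ dist (y i) (y j)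

/-- Antitone in `δ`. [folklore] -/
theorem sepGS_anti {δ δ' : ℝ} (h : δ ≤ δ') (hS : SepGS δ') : SepGS δ :=
  fun N y hy i j hij => h.trans (hS N y hy i j hij)

/-- Some positive separation (tree: `LennardJonesMinimalDistance_holds`, `δ = 1/3`). [folklore] -/
theorem sepGS_pos : ∃ δ : ℝ, 0 < δ ∧ SepGS δ := by
  obtain ⟨δ, hδ, h⟩ := LennardJonesMinimalDistance_holds
  exact ⟨δ, hδ, fun N y hy i j hij => h N y hy i j hij⟩

/-- `δ = 0.684` from the named fact `Yuhjtman2015_minDistance`. [cite: Yuhjtman2015, Cor. 7] -/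
theorem sepGS_of_yuhjtman (h : Yuhjtman2015_minDistance) : SepGS 0.684 :=
  fun N y hy i j hij => (h N y hy i j hij).le

/-- `HalfSpaceCap T δ` — HALF-SPACE CAPACITY: a finite point set in the closed half-space `{v | 0 ≤ ⟪v,u⟫}` (`u ≠ 0`),
`δ`-separated and at distance `≥ δ` from `0`, binds a particle at `0` by at most `T`. [folklore] -/
def HalfSpaceCap (T δ : ℝ) : Prop :=
  ∀ (m : ℕ) (p : Fin m → E3) (u : E3), u ≠ 0 →
    (∀ k, δ ≤ ‖p k‖) → (∀ k l, k ≠ l → δ ≤ dist (p k) (p l)) → (∀ k, 0 ≤ inner ℝ (p k) u) →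
      -T ≤ ∑ k, lennardJones ‖p k‖

/-- Monotone in `T` and in `δ`. [folklore] -/
theorem halfSpaceCap_mono {T T' δ δ' : ℝ} (hT : T ≤ T') (hδ : δ ≤ δ') (h : HalfSpaceCap T δ) : HalfSpaceCap T' δ' :=
  fun m p u hu h1 h2 h3 =>
    (neg_le_neg hT).trans (h m p u hu (fun k => hδ.trans (h1 k)) (fun k l hkl => hδ.trans (h2 k l hkl)) h3)

/-- `HullBinding E` — every ground state on `n + 1` particles has a particle bound by at most `E`. [folklore] -/
def HullBinding (E : ℝ) : Prop :=
  ∀ (n : ℕ) (y : Fin (n + 1) → E3), IsGroundState lennardJones y → ∃ i : Fin (n + 1), -E ≤ siteEnergy lennardJones y i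

/-- `IncrementFloor T` — `E(N+1) − E(N) ≥ −T` for every `N`. [folklore] -/
def IncrementFloor (T : ℝ) : Prop :=
  ∀ N : ℕ, -T ≤ groundStateEnergy lennardJones 3 (N + 1) - groundStateEnergy lennardJones 3 N

/-- Monotone in `E`. [folklore] -/
theorem hullBinding_mono {E E' : ℝ} (h : E ≤ E') (hH : HullBinding E) : HullBinding E' := fun n y hy => by
  obtain ⟨i, hi⟩ := hH n y hy
  exact ⟨i, by linarith⟩

/-- Monotone in `T`. [folklore] -/
theorem incrementFloor_mono {T T' : ℝ} (h : T ≤ T') (hI : IncrementFloor T) : IncrementFloor T' := fun N => by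
  have := hI N
  linarith

/-- Hull binding ⇒ increment floor (removal lemma `siteEnergy_le_increment` + existence of ground states). [folklore] -/
theorem incrementFloor_of_hullBinding {E : ℝ} (h : HullBinding E) : IncrementFloor E := by
  intro N
  obtain ⟨z, hz⟩ := LennardJonesGroundStatesExist_holds (N + 1)
  obtain ⟨i, hi⟩ := h N z hz
  -- removal: `E(N) ≤ E(z ∘ i.succAbove) = E(z) − 𝓔ⁱ(z)` (as in `GrandCanonicalSelectionKosselPointwise.siteEnergy_le_increment`)
  have hinj : Function.Injective (z ∘ i.succAbove) := hz.1.comp Fin.succAbove_right_injective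
  have hle : groundStateEnergy lennardJones 3 N ≤ interactionEnergy lennardJones (z ∘ i.succAbove) :=
    groundStateEnergy_lennardJones_le hinj
  have hsplit := interactionEnergy_eq_succAbove_add_siteEnergy lennardJones lennardJones_zero z i
  have hE : interactionEnergy lennardJones z = groundStateEnergy lennardJones 3 (N + 1) := hz.2
  linarith

/-- **Farthest-point lemma.** If `q` is no farther from `a` than `c` is, then `q` lies in the closed half-space through `c`
with inward normal `a − c`. [folklore] -/
theorem inner_nonneg_of_dist_le {a c q : E3} (h : dist q a ≤ dist c a) : 0 ≤ inner ℝ (q - c) (a - c) := by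
  have h1 : inner ℝ (q - c) (a - c) = inner ℝ (q - a) (a - c) + ‖a - c‖ ^ 2 := by
    have : q - c = (q - a) + (a - c) := by abel
    rw [this, inner_add_left, real_inner_self_eq_norm_sq]
  have h2 : |inner ℝ (q - a) (a - c)| ≤ ‖q - a‖ * ‖a - c‖ := abs_real_inner_le_norm _ _
  have h3 : ‖q - a‖ ≤ ‖a - c‖ := by rwa [← dist_eq_norm, ← dist_eq_norm, dist_comm a c]
  have h4 := neg_abs_le (inner ℝ (q - a) (a - c))
  have h5 : ‖q - a‖ * ‖a - c‖ ≤ ‖a - c‖ * ‖a - c‖ := mul_le_mul_of_nonneg_right h3 (norm_nonneg _)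
  rw [h1, pow_two]
  linarith

/-- **KERNEL.** `SepGS δ ∧ HalfSpaceCap T δ ⇒ HullBinding T`: in a ground state, the particle farthest from particle `0`
sees every other particle in the closed half-space with inward normal pointing to particle `0`; all of them are `δ`-far
from it and from each other; the capacity bounds its binding. [folklore] -/
theorem hullBinding_of_sep_cap {T δ : ℝ} (hS : SepGS δ) (hC : HalfSpaceCap T δ) : HullBinding T := by
  intro n y hy
  rcases Nat.eq_zero_or_pos n with hn | hn
  · -- one particle: its site energy is the empty sum; the capacity of the empty set gives `−T ≤ 0`
    subst hn
    refine ⟨0, ?_⟩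
    obtain ⟨u, hu⟩ := exists_ne (0 : E3)
    have hcap := hC 0 (fun k => Fin.elim0 k) u hu (fun k => Fin.elim0 k) (fun k => Fin.elim0 k) (fun k => Fin.elim0 k)
    have hsite : siteEnergy lennardJones y 0 = 0 := by
      rw [siteEnergy_eq_sum_succAbove]
      simp
    rw [hsite]
    simpa using hcap
  · -- at least two particles: the farthest particle `i` from particle `0`
    have hne : (Finset.univ.erase (0 : Fin (n + 1))).Nonempty :=
      ⟨⟨1, by omega⟩, Finset.mem_erase.2 ⟨by simp [Fin.ext_iff], Finset.mem_univ _⟩⟩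
    obtain ⟨i, hi_mem, hi_max⟩ := Finset.exists_max_image (Finset.univ.erase (0 : Fin (n + 1)))
      (fun k => dist (y k) (y 0)) hne
    have hi0 : i ≠ 0 := Finset.ne_of_mem_erase hi_mem
    refine ⟨i, ?_⟩
    set u : E3 := y 0 - y i with hu_def
    have hu0 : u ≠ 0 := by
      intro h
      exact hi0 (hy.1 (sub_eq_zero.1 h)).symm
    set p : Fin n → E3 := fun k => y (i.succAbove k) - y i with hp_def
    have hnorm : ∀ k, ‖p k‖ = dist (y i) (y (i.succAbove k)) := fun k => by
      rw [hp_def, dist_comm, dist_eq_norm]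
    have h1 : ∀ k, δ ≤ ‖p k‖ := fun k => by
      rw [hnorm]
      exact hS _ y hy _ _ (Fin.succAbove_ne i k).symm
    have h2 : ∀ k l, k ≠ l → δ ≤ dist (p k) (p l) := fun k l hkl => by
      have : dist (p k) (p l) = dist (y (i.succAbove k)) (y (i.succAbove l)) := by
        simp only [hp_def]
        exact dist_sub_right _ _ _
      rw [this]
      exact hS _ y hy _ _ (fun h => hkl (Fin.succAbove_right_injective h))
    have h3 : ∀ k, 0 ≤ inner ℝ (p k) u := fun k => by
      by_cases hk : i.succAbove k = 0
      · have : p k = u := by rw [hp_def, hu_def]; simp only [hk]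
        rw [this]
        exact real_inner_self_nonneg
      · exact inner_nonneg_of_dist_le (hi_max _ (Finset.mem_erase.2 ⟨hk, Finset.mem_univ _⟩))
    have hcap := hC n p u hu0 h1 h2 h3
    have hsite : siteEnergy lennardJones y i = ∑ k, lennardJones ‖p k‖ := by
      rw [siteEnergy_eq_sum_succAbove]
      exact Finset.sum_congr rfl fun k _ => by rw [hnorm]
    rw [hsite]
    exact hcap

/-- **The door's exchange rate**: `SepGS δ ∧ HalfSpaceCap T δ ⇒ IncrementFloor T` (any `T`, `δ`). [folklore] -/
theorem incrementFloor_of_sep_cap {T δ : ℝ} (hS : SepGS δ) (hC : HalfSpaceCap T δ) : IncrementFloor T :=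
  incrementFloor_of_hullBinding (hullBinding_of_sep_cap hS hC)

/-- `e⋆` = the periodic infimum of the Lennard-Jones energy per particle (`ChargedEnergyGapNegative.eStar`). [folklore] -/
def eInf : ℝ := ChargedEnergyGapNegative.eStar

/-- **PROVED RUNG** `HullBinding (−2e⋆)`: `Σ_i 𝓔ⁱ = 2E(y) ≥ 2(n+1)e⋆` (LANDED `card_mul_eStar_le`), so some particle has
`𝓔ⁱ ≥ 2e⋆`. [folklore] -/
theorem hullBinding_two_eStar : HullBinding (-(2 * eInf)) := by
  intro n y hy
  by_contra h
  have h' : ∀ i : Fin (n + 1), siteEnergy lennardJones y i < 2 * eInf := fun i =>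
    lt_of_not_ge fun hi => h ⟨i, by linarith⟩
  have hlt : ∑ i : Fin (n + 1), siteEnergy lennardJones y i < ∑ _i : Fin (n + 1), (2 * eInf) :=
    Finset.sum_lt_sum_of_nonempty ⟨0, Finset.mem_univ _⟩ fun i _ => h' i
  have hconst : ∑ _i : Fin (n + 1), (2 * eInf) = ((n + 1 : ℕ) : ℝ) * (2 * eInf) := by
    simp [Finset.sum_const, Finset.card_univ, Fintype.card_fin]
  have h2 := two_mul_interactionEnergy lennardJones y
  have h0 : ((n + 1 : ℕ) : ℝ) * eInf ≤ interactionEnergy lennardJones y :=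
    ChargedEnergyGapNegative.card_mul_eStar_le hy.1
  linarith

/-- Door-free end of the dial: `E(N+1) − E(N) ≥ 2e⋆` for every `N`. [folklore] -/
theorem incrementFloor_two_eStar : IncrementFloor (-(2 * eInf)) :=
  incrementFloor_of_hullBinding hullBinding_two_eStar

/-- Every `T ≥ 2|e⋆|` door is free. [folklore] -/
theorem incrementFloor_of_le {T : ℝ} (hT : -(2 * eInf) ≤ T) : IncrementFloor T :=
  incrementFloor_mono hT incrementFloor_two_eStar

end Summit.AtomisticToContinuum.Crystallization.Theorems.SeparationCeilingDoor

end
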